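import Mathlib
import HarnessLib
import Literature.Analysis.FluidPDE.SuitableWeak
import Literature.Analysis.FluidPDE.LocalTypeI
import Literature.Analysis.FluidPDE.LocalTypeIReverseTools
import Literature.Analysis.FluidPDE.LocalPlainPressureBound
import Literature.Analysis.FluidPDE.Seregin2020CubicLowerBound
import Summits.NavierStokesRegularity.NavierStokesRegularity.Theorems.TypeIQuarterGateScarEnvelopeTypeITopEpsilonRegularity

/-!
# Crux `TypeIQuarterGate.ScarEnvelopeTypeI` (stmt-NavierStokesRegularity-23843), line `slice_budget` —
# CKN AT THE TOP TIME, file 2: the final-time singular set of a local suitable weak solution with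
# a Type-I energy bound is `H¹`-null

Second helper file (no new definitions) of the top-time CKN tool for the deciding stub SD of line
`slice_budget` (mechanism and role: file 1, `…TopEpsilonRegularity.lean` — it kills every
concentration scenario whose zoom limit is singular at the final time along a set of positive
one-dimensional Hausdorff measure: coherent filament, arc-like swarm, sheet, fog).
* `hausdorffMeasure_topSingular_eq_zero` — suitable pair on `Q ⊇ (t₀ − R₀², t₀) × U`, `∫∫|∇u|² < ∞`
  there, `|U| < ∞`; `S` = points `x` (`B(x, R₀) ⊆ U`) with `(t₀, x)` backward-singular,
  `A(ρ; (t₀, x)) ≤ K`, `D(ρ; (t₀, x)) < ∞` (`0 < ρ ≤ R₀`) ⇒ `μH[1] S = 0` (file 1 + spatial Vitali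
  `Vitali.exists_disjoint_subfamily_covering_enlargement_closedBall` + `hausdorffMeasure_le_liminf_tsum`
  + absolute continuity of `∫∫|∇u|²` on the shrinking slab).
* `hausdorffMeasure_topSingular_eq_zero_of_typeIBound` — Albritton–Barker form (`Q(z₀, R)` of
  Def. 2.1 class, `𝐈 < ∞`); `hausdorffMeasure_topSingular_eq_zero_slab` — slab form (the shape the
  blow-up engine produces; pressure re-gauged by a ball mean).
«By the ε-regularity theory, one-dimensional Hausdorff's measure of singular points at the blow up
time is equal to zero» [Seregin 2014, §7.2 after (7.2.2); §6 p. 108] — here at the TOP time of a LOCAL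
solution, the energy bound replacing the interior argument.  HONEST FRAMING: tools only; SD, the crux
`ScarEnvelopeTypeI`, its parent and the summit are OPEN and nothing here is credited toward them.
-/

noncomputable section

-- the summit-side namespace `Summit.NavierStokesRegularity.NavierStokesRegularity.…` (single-conjunct
-- summit, D-0017) repeats a component by design; the dupNamespace linter would flag every declaration.
set_option linter.dupNamespace false

namespace Summit.NavierStokesRegularity.NavierStokesRegularity.Cruxes.ScarEnvelopeTypeI.SliceBudget

open MeasureTheory Set Function Filter Topology TopologicalSpace Metric
open scoped NNReal ENNReal
open Literature.Analysis Literature.Analysis.FluidPDE Literature.Analysis.FluidPDE.Seregin2020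

/-! ### `H¹`-nullity of the top-time singular set -/

/-- **CKN at the top time, under an energy bound: the final-time singular set is `H¹`-null.**  For a
suitable weak solution (`ν = 1`, no force) on an open `Q ⊇ (t₀ − R₀², t₀) × U` with weak gradient `G`,
`∫∫ |∇u|² < ∞` on that slab and `|U| < ∞`: a set `S` of points `x` (`B(x, R₀) ⊆ U`) at which `(t₀, x)`
is a BACKWARD singular point while `A(ρ; (t₀, x)) ≤ K`, `D(ρ; (t₀, x)) < ∞` (`0 < ρ ≤ R₀`) has
`μH[1] S = 0` [Seregin 2014, §7.2; §6 p. 108].  Proof: `not_isBackwardSingularPoint_of_cknE_le` yields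
around every `x ∈ S` balls of arbitrarily small radius with `ρ η₀ < ∫∫_{Q_ρ(t₀,x)} |∇u|²`; a Vitali
subfamily of disjoint balls covers `S` after enlarging by `4`, so
`μH[1] S ≤ liminf 8 η₀⁻¹ ∫∫_{(t₀−δ²,t₀)×U} |∇u|² = 0`. -/
theorem hausdorffMeasure_topSingular_eq_zero
    {Q : Opens (ℝ × EuclideanSpace ℝ (Fin 3))}
    {u : ℝ → EuclideanSpace ℝ (Fin 3) → EuclideanSpace ℝ (Fin 3)}
    {p : ℝ → EuclideanSpace ℝ (Fin 3) → ℝ}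
    {G : ℝ → EuclideanSpace ℝ (Fin 3) → EuclideanSpace ℝ (Fin 3) →L[ℝ] EuclideanSpace ℝ (Fin 3)}
    (hsw : IsSuitableWeakSolutionOn Q 1 0 u p) (hG : HasWeakSpatialGradientOn Q u G)
    {t₀ R₀ : ℝ} (hR₀ : 0 < R₀) {U : Set (EuclideanSpace ℝ (Fin 3))}
    (hslab : Ioo (t₀ - R₀ ^ 2) t₀ ×ˢ U ⊆ (Q : Set (ℝ × EuclideanSpace ℝ (Fin 3))))
    (hUm : MeasurableSet U) (hUvol : volume U ≠ ∞)
    (hgrad : ∫⁻ w in Ioo (t₀ - R₀ ^ 2) t₀ ×ˢ U, ENNReal.ofReal (frobeniusNormSq (G w.1 w.2)) ≠ ∞)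
    {S : Set (EuclideanSpace ℝ (Fin 3))} (hSU : ∀ x ∈ S, ball x R₀ ⊆ U) {K : ℝ≥0}
    (hA : ∀ x ∈ S, ∀ ρ, 0 < ρ → ρ ≤ R₀ → cknAEss ρ (t₀, x) u ≤ K)
    (hD : ∀ x ∈ S, ∀ ρ, 0 < ρ → ρ ≤ R₀ → cknD ρ (t₀, x) p ≠ ∞)
    (hS : ∀ x ∈ S, IsBackwardSingularPoint u (t₀, x)) :
    μH[1] S = 0 := by
  obtain ⟨η₀, hη₀, H⟩ := not_isBackwardSingularPoint_of_cknE_le K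
  set g : ℝ × EuclideanSpace ℝ (Fin 3) → ℝ≥0∞ := fun w => ENNReal.ofReal (frobeniusNormSq (G w.1 w.2))
    with hgdef
  -- ### the slabs `(t₀ − δ², t₀) × U`
  set slab : ℝ → Set (ℝ × EuclideanSpace ℝ (Fin 3)) := fun δ => Ioo (t₀ - δ ^ 2) t₀ ×ˢ U with hslabdef
  have hslab_mono : ∀ δ, 0 < δ → δ ≤ R₀ → slab δ ⊆ slab R₀ := by
    intro δ hδ hδR w hw
    refine ⟨⟨?_, hw.1.2⟩, hw.2⟩
    have : δ ^ 2 ≤ R₀ ^ 2 := pow_le_pow_left₀ hδ.le hδR 2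
    linarith [hw.1.1]
  have hcyl : ∀ x ∈ S, ∀ δ ρ, 0 < ρ → ρ ≤ δ → δ ≤ R₀ →
      parabolicCylinder ρ ((t₀, x) : ℝ × EuclideanSpace ℝ (Fin 3)) ⊆ slab δ := by
    intro x hx δ ρ hρ hρδ hδR w hw
    rw [mem_parabolicCylinder] at hw
    refine ⟨⟨?_, hw.1.2⟩, ?_⟩
    · have : ρ ^ 2 ≤ δ ^ 2 := pow_le_pow_left₀ hρ.le hρδ 2
      simp only at hw
      linarith [hw.1.1]
    · exact hSU x hx (mem_ball.2 (hw.2.trans_le (hρδ.trans hδR)))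
  -- ### large dissipation at arbitrarily small scales around every point of `S`
  have key : ∀ x ∈ S, ∀ δ, 0 < δ → δ ≤ R₀ →
      ∃ ρ, 0 < ρ ∧ ρ ≤ δ ∧ ENNReal.ofReal η₀ < cknE ρ ((t₀, x) : ℝ × EuclideanSpace ℝ (Fin 3)) G := by
    intro x hx δ hδ hδR
    by_contra hcon
    push Not at hcon
    exact H Q u p G hsw hG (t₀, x) δ hδ (((hcyl x hx δ δ hδ le_rfl hδR).trans (hslab_mono δ hδ hδR)).trans
      hslab) (hD x hx δ hδ hδR) (fun ρ hρ hρδ => hA x hx ρ hρ (hρδ.trans hδR))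
      (fun ρ hρ hρδ => hcon ρ hρ hρδ) (hS x hx)
  -- ### the scales `δₙ = R₀ / (n+1)` and the Vitali subfamilies
  set δ : ℕ → ℝ := fun n => R₀ * (1 / ((n : ℝ) + 1)) with hδdef
  have hδ0 : ∀ n, 0 < δ n := fun n => by positivity
  have hδR : ∀ n, δ n ≤ R₀ := fun n => by
    have h1 : 1 / ((n : ℝ) + 1) ≤ 1 := by
      rw [div_le_one (by positivity)]; linarith [n.cast_nonneg (α := ℝ)]
    calc δ n = R₀ * (1 / ((n : ℝ) + 1)) := rfl
      _ ≤ R₀ * 1 := by gcongr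
      _ = R₀ := mul_one R₀
  have hδlim : Tendsto δ atTop (𝓝 0) := by
    have := tendsto_one_div_add_atTop_nhds_zero_nat.const_mul R₀
    rwa [mul_zero] at this
  set tn : ℕ → Set (EuclideanSpace ℝ (Fin 3) × ℝ) := fun n =>
    {a | a.1 ∈ S ∧ 0 < a.2 ∧ a.2 ≤ δ n ∧
      ENNReal.ofReal η₀ < cknE a.2 ((t₀, a.1) : ℝ × EuclideanSpace ℝ (Fin 3)) G} with htn
  have hVit : ∀ n, ∃ un ⊆ tn n,
      (un.PairwiseDisjoint fun a => closedBall a.1 a.2) ∧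
        ∀ a ∈ tn n, ∃ b ∈ un, closedBall a.1 a.2 ⊆ closedBall b.1 (4 * b.2) := fun n =>
    Vitali.exists_disjoint_subfamily_covering_enlargement_closedBall (tn n) Prod.fst Prod.snd (δ n)
      (fun a ha => ha.2.2.1) 4 (by norm_num)
  choose un hunt hundisj huncov using hVit
  have hun2 : ∀ n, ∀ b ∈ un n, 0 < b.2 := fun n b hb => (hunt n hb).2.1
  have hcount : ∀ n, (un n).Countable := fun n =>
    (hundisj n).countable_of_nonempty_interior fun b hb => by
      rw [interior_closedBall _ (hun2 n b hb).ne']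
      exact nonempty_ball.2 (hun2 n b hb)
  haveI : ∀ n, Countable (un n) := fun n => (hcount n).to_subtype
  -- ### the covers `B(x_b, 4 r_b)`, `b ∈ uₙ`
  set T : ∀ n : ℕ, un n → Set (EuclideanSpace ℝ (Fin 3)) := fun n b => closedBall b.1.1 (4 * b.1.2)
    with hTdef
  have hdiam : ∀ n (b : un n), Metric.ediam (T n b) ≤ ENNReal.ofReal (8 * b.1.2) := by
    intro n b
    refine Metric.ediam_le_of_forall_dist_le fun y hy y' hy' => ?_
    rw [mem_closedBall] at hy hy'
    calc dist y y' ≤ dist y b.1.1 + dist y' b.1.1 := dist_triangle_right _ _ _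
      _ ≤ 4 * b.1.2 + 4 * b.1.2 := add_le_add hy hy'
      _ = 8 * b.1.2 := by ring
  have hdiam' : ∀ᶠ n in atTop, ∀ b : un n, Metric.ediam (T n b) ≤ ENNReal.ofReal (8 * δ n) :=
    Eventually.of_forall fun n b => (hdiam n b).trans
      (ENNReal.ofReal_le_ofReal (by linarith [(hunt n b.2).2.2.1]))
  have hcover : ∀ᶠ n in atTop, S ⊆ ⋃ b : un n, T n b := Eventually.of_forall fun n x hx => by
    obtain ⟨ρ, hρ, hρδ, hE⟩ := key x hx (δ n) (hδ0 n) (hδR n)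
    obtain ⟨b, hb, hsub⟩ := huncov n (x, ρ) ⟨hx, hρ, hρδ, hE⟩
    exact mem_iUnion.2 ⟨⟨b, hb⟩, hsub (mem_closedBall_self hρ.le)⟩
  have hr : Tendsto (fun n => ENNReal.ofReal (8 * δ n)) atTop (𝓝 0) := by
    have := ENNReal.tendsto_ofReal (hδlim.const_mul 8)
    rwa [mul_zero, ENNReal.ofReal_zero] at this
  have hμ := Measure.hausdorffMeasure_le_liminf_tsum (1 : ℝ) S (l := atTop) (fun n => ENNReal.ofReal (8 * δ n))
    hr T hdiam' hcover
  -- ### the sums are bounded by the dissipation in the slab `(t₀ − δₙ², t₀) × U`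
  set cyl : ∀ n : ℕ, un n → Set (ℝ × EuclideanSpace ℝ (Fin 3)) := fun n b =>
    parabolicCylinder b.1.2 ((t₀, b.1.1) : ℝ × EuclideanSpace ℝ (Fin 3)) with hcyldef
  have hcyl_slab : ∀ n (b : un n), cyl n b ⊆ slab (δ n) := fun n b =>
    hcyl b.1.1 (hunt n b.2).1 (δ n) b.1.2 (hun2 n b.1 b.2) (hunt n b.2).2.2.1 (hδR n)
  have hcyl_disj : ∀ n, Pairwise (Disjoint on cyl n) := by
    intro n b b' hbb'
    have hne : (b : EuclideanSpace ℝ (Fin 3) × ℝ) ≠ b' := fun h => hbb' (Subtype.ext h)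
    have hd := hundisj n b.2 b'.2 hne
    rw [Function.onFun, hcyldef]
    simp only [parabolicCylinder]
    rw [Set.disjoint_prod]
    exact Or.inr ((hd.mono ball_subset_closedBall ball_subset_closedBall))
  have hsum : ∀ n, ∑' b : un n, Metric.ediam (T n b) ^ (1 : ℝ) ≤
      ENNReal.ofReal 8 * (ENNReal.ofReal η₀)⁻¹ * ∫⁻ w in slab (δ n), g w := by
    intro n
    have hterm : ∀ b : un n, Metric.ediam (T n b) ^ (1 : ℝ) ≤
        ENNReal.ofReal 8 * (ENNReal.ofReal η₀)⁻¹ * ∫⁻ w in cyl n b, g w := by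
      intro b
      rw [ENNReal.rpow_one]
      have hb2 : 0 < b.1.2 := hun2 n b.1 b.2
      have hE : ENNReal.ofReal η₀ < cknE b.1.2 ((t₀, b.1.1) : ℝ × EuclideanSpace ℝ (Fin 3)) G :=
        (hunt n b.2).2.2.2
      have hr0 : ENNReal.ofReal b.1.2 ≠ 0 := (ENNReal.ofReal_pos.2 hb2).ne'
      have hI : ENNReal.ofReal b.1.2 * ENNReal.ofReal η₀ ≤ ∫⁻ w in cyl n b, g w := by
        calc ENNReal.ofReal b.1.2 * ENNReal.ofReal η₀
            ≤ ENNReal.ofReal b.1.2 * cknE b.1.2 ((t₀, b.1.1) : ℝ × EuclideanSpace ℝ (Fin 3)) G :=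
              mul_le_mul' le_rfl hE.le
          _ = ∫⁻ w in cyl n b, g w := by
              rw [cknE, ← mul_assoc, ENNReal.mul_inv_cancel hr0 ENNReal.ofReal_ne_top, one_mul]
      have hη0 : ENNReal.ofReal η₀ ≠ 0 := (ENNReal.ofReal_pos.2 hη₀).ne'
      calc Metric.ediam (T n b) ≤ ENNReal.ofReal (8 * b.1.2) := hdiam n b
        _ = ENNReal.ofReal 8 * (ENNReal.ofReal η₀)⁻¹ * (ENNReal.ofReal b.1.2 * ENNReal.ofReal η₀) := by
            rw [ENNReal.ofReal_mul (by norm_num), mul_assoc, mul_comm (ENNReal.ofReal b.1.2),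
              ← mul_assoc (ENNReal.ofReal η₀)⁻¹, ENNReal.inv_mul_cancel hη0 ENNReal.ofReal_ne_top,
              one_mul]
        _ ≤ ENNReal.ofReal 8 * (ENNReal.ofReal η₀)⁻¹ * ∫⁻ w in cyl n b, g w := mul_le_mul' le_rfl hI
    calc ∑' b : un n, Metric.ediam (T n b) ^ (1 : ℝ)
        ≤ ∑' b : un n, ENNReal.ofReal 8 * (ENNReal.ofReal η₀)⁻¹ * ∫⁻ w in cyl n b, g w :=
          ENNReal.tsum_le_tsum hterm
      _ = ENNReal.ofReal 8 * (ENNReal.ofReal η₀)⁻¹ * ∑' b : un n, ∫⁻ w in cyl n b, g w :=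
          ENNReal.tsum_mul_left
      _ = ENNReal.ofReal 8 * (ENNReal.ofReal η₀)⁻¹ * ∫⁻ w in ⋃ b : un n, cyl n b, g w := by
          rw [lintegral_iUnion (fun b => (isOpen_parabolicCylinder _ _).measurableSet) (hcyl_disj n)]
      _ ≤ ENNReal.ofReal 8 * (ENNReal.ofReal η₀)⁻¹ * ∫⁻ w in slab (δ n), g w :=
          mul_le_mul' le_rfl (lintegral_mono_set (iUnion_subset (hcyl_slab n)))
  -- ### the dissipation in the shrinking slabs tends to zero
  have hmeas : ∀ d, MeasurableSet (slab d) := fun d => measurableSet_Ioo.prod hUm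
  have hfin : ∫⁻ w, g w ∂(volume.restrict (slab R₀)) ≠ ∞ := hgrad
  have hvol : Tendsto ((volume.restrict (slab R₀)) ∘ fun n => slab (δ n)) atTop (𝓝 0) := by
    have hup : Tendsto (fun n => ENNReal.ofReal (δ n ^ 2) * volume U) atTop (𝓝 0) := by
      have h1 : Tendsto (fun n => ENNReal.ofReal (δ n ^ 2)) atTop (𝓝 0) := by
        have := ENNReal.tendsto_ofReal (hδlim.pow 2)
        rwa [zero_pow two_ne_zero, ENNReal.ofReal_zero] at this
      have h2 := ENNReal.Tendsto.mul_const h1 (Or.inr hUvol)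
      rwa [zero_mul] at h2
    refine tendsto_of_tendsto_of_tendsto_of_le_of_le tendsto_const_nhds hup (fun _ => bot_le)
      fun n => ?_
    calc ((volume.restrict (slab R₀)) ∘ fun n => slab (δ n)) n
        = volume (slab (δ n) ∩ slab R₀) := Measure.restrict_apply (hmeas _)
      _ ≤ volume (slab (δ n)) := measure_mono inter_subset_left
      _ = volume (Ioo (t₀ - δ n ^ 2) t₀) * volume U := Measure.prod_prod _ _
      _ = ENNReal.ofReal (δ n ^ 2) * volume U := by
          rw [Real.volume_Ioo, show t₀ - (t₀ - δ n ^ 2) = δ n ^ 2 by ring]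
  have hI : Tendsto (fun n => ∫⁻ w in slab (δ n), g w) atTop (𝓝 0) := by
    have h := tendsto_setLIntegral_zero (μ := volume.restrict (slab R₀)) hfin hvol
    refine h.congr' (Eventually.of_forall fun n => ?_)
    rw [Measure.restrict_restrict (hmeas _), inter_eq_left.2 (hslab_mono _ (hδ0 n) (hδR n))]
  have hcoef : ENNReal.ofReal 8 * (ENNReal.ofReal η₀)⁻¹ ≠ ∞ :=
    ENNReal.mul_ne_top ENNReal.ofReal_ne_top
      (ENNReal.inv_ne_top.2 (ENNReal.ofReal_pos.2 hη₀).ne')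
  have ha : Tendsto (fun n => ENNReal.ofReal 8 * (ENNReal.ofReal η₀)⁻¹ * ∫⁻ w in slab (δ n), g w)
      atTop (𝓝 0) := by
    have := ENNReal.Tendsto.const_mul hI (Or.inr hcoef)
    rwa [mul_zero] at this
  have hlim : liminf (fun n => ∑' b : un n, Metric.ediam (T n b) ^ (1 : ℝ)) atTop ≤ 0 := by
    calc liminf (fun n => ∑' b : un n, Metric.ediam (T n b) ^ (1 : ℝ)) atTop
        ≤ liminf (fun n => ENNReal.ofReal 8 * (ENNReal.ofReal η₀)⁻¹ * ∫⁻ w in slab (δ n), g w) atTop :=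
          liminf_le_liminf (Eventually.of_forall hsum)
      _ = 0 := ha.liminf_eq
  exact le_antisymm (hμ.trans hlim) bot_le

/-! ### The Albritton–Barker form: `𝐈 < ∞` on a parabolic ball -/

/-- **Top-time singular sets of local Type-I solutions are `H¹`-null — Albritton–Barker form.**  In a
parabolic ball `Q(z₀, R)` of Def. 2.1 class (`IsSuitableWeakSolutionInBall`) with a weak gradient `G`
and `𝐈(Q(z₀, R)) < ∞`, the set of `x ∈ B(x₀, R/2)` at which the TOP vertex `(t₀, x)` is backward
singular has `μH[1] = 0`: no singular filaments, arcs or sheets at the final time of a Type-I object. -/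
theorem hausdorffMeasure_topSingular_eq_zero_of_typeIBound
    {u : ℝ → EuclideanSpace ℝ (Fin 3) → EuclideanSpace ℝ (Fin 3)}
    {p : ℝ → EuclideanSpace ℝ (Fin 3) → ℝ}
    {G : ℝ → EuclideanSpace ℝ (Fin 3) → EuclideanSpace ℝ (Fin 3) →L[ℝ] EuclideanSpace ℝ (Fin 3)}
    {z₀ : ℝ × EuclideanSpace ℝ (Fin 3)} {R : ℝ} (hR : 0 < R)
    (hball : IsSuitableWeakSolutionInBall R z₀ u p)
    (hG : HasWeakSpatialGradientOn (parabolicCylinderOpens R z₀) u G)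
    (hI : typeIBound (parabolicCylinder R z₀) u p G < ⊤) :
    μH[1] {x ∈ ball z₀.2 (R / 2) | IsBackwardSingularPoint u (z₀.1, x)} = 0 := by
  obtain ⟨hsw, -, -, hp⟩ := hball
  set I : ℝ≥0∞ := typeIBound (parabolicCylinder R z₀) u p G with hIdef
  have hItop : I ≠ ⊤ := hI.ne
  set S : Set (EuclideanSpace ℝ (Fin 3)) :=
    {x ∈ ball z₀.2 (R / 2) | IsBackwardSingularPoint u (z₀.1, x)} with hSdef
  have hR2 : 0 < R / 2 := by positivity
  -- sub-cylinders with top vertices over the half ball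
  have hsub : ∀ x ∈ ball z₀.2 (R / 2), ∀ ρ, 0 < ρ → ρ ≤ R / 2 →
      parabolicCylinder ρ ((z₀.1, x) : ℝ × EuclideanSpace ℝ (Fin 3)) ⊆ parabolicCylinder R z₀ := by
    intro x hx ρ hρ hρR w hw
    rw [mem_parabolicCylinder] at hw ⊢
    simp only at hw
    refine ⟨⟨?_, hw.1.2⟩, ?_⟩
    · have : ρ ^ 2 ≤ R ^ 2 := by nlinarith
      linarith [hw.1.1]
    · rw [mem_ball] at hx
      calc dist w.2 z₀.2 ≤ dist w.2 x + dist x z₀.2 := dist_triangle _ _ _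
        _ < ρ + R / 2 := add_lt_add hw.2 hx
        _ ≤ R := by linarith
  -- the slab `(t₀ − (R/2)², t₀) × B(x₀, R)` inside the ball
  have hslab : Ioo (z₀.1 - (R / 2) ^ 2) z₀.1 ×ˢ ball z₀.2 R ⊆
      ((parabolicCylinderOpens R z₀ : Opens (ℝ × EuclideanSpace ℝ (Fin 3))) :
        Set (ℝ × EuclideanSpace ℝ (Fin 3))) := by
    rintro ⟨s, y⟩ ⟨hs, hy⟩
    rw [coe_parabolicCylinderOpens, mem_parabolicCylinder]
    refine ⟨⟨?_, hs.2⟩, mem_ball.1 hy⟩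
    have : (R / 2) ^ 2 ≤ R ^ 2 := by nlinarith
    linarith [hs.1]
  have hslab' : Ioo (z₀.1 - (R / 2) ^ 2) z₀.1 ×ˢ ball z₀.2 R ⊆ parabolicCylinder R z₀ := hslab
  -- `∫∫ |∇u|² < ∞` on the slab, from `E(R; z₀) ≤ 𝐈`
  have hgradQ : ∫⁻ w in parabolicCylinder R z₀, ENNReal.ofReal (frobeniusNormSq (G w.1 w.2)) ≠ ∞ := by
    have hE : cknE R z₀ G ≤ I := cknE_le_abScaledSum.trans (abScaledSum_le_typeIBound hR subset_rfl)
    have hR0 : ENNReal.ofReal R ≠ 0 := (ENNReal.ofReal_pos.2 hR).ne'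
    have h1 : ∫⁻ w in parabolicCylinder R z₀, ENNReal.ofReal (frobeniusNormSq (G w.1 w.2)) ≤
        ENNReal.ofReal R * I := by
      rw [cknE] at hE
      exact (ENNReal.inv_mul_le_iff hR0 ENNReal.ofReal_ne_top).1 hE
    exact ne_top_of_le_ne_top (ENNReal.mul_ne_top ENNReal.ofReal_ne_top hItop) h1
  have hgrad : ∫⁻ w in Ioo (z₀.1 - (R / 2) ^ 2) z₀.1 ×ˢ ball z₀.2 R,
      ENNReal.ofReal (frobeniusNormSq (G w.1 w.2)) ≠ ∞ :=
    ne_top_of_le_ne_top hgradQ (lintegral_mono_set hslab')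
  -- `D(ρ; (t₀, x)) < ∞` from `p ∈ L^{3/2}(Q(z₀, R))`
  have hpint : ∫⁻ w in parabolicCylinder R z₀, ‖p w.1 w.2‖ₑ ^ (3 / 2 : ℝ) < ∞ := by
    have h := lintegral_rpow_enorm_lt_top_of_eLpNorm_lt_top (by norm_num)
      (ENNReal.div_ne_top ENNReal.ofNat_ne_top two_ne_zero) hp.eLpNorm_lt_top
    have h32 : ((3 / 2 : ℝ≥0∞)).toReal = (3 / 2 : ℝ) := by
      rw [ENNReal.toReal_div]; norm_num
    rw [h32] at h
    exact h
  have hD : ∀ x ∈ S, ∀ ρ, 0 < ρ → ρ ≤ R / 2 →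
      cknD ρ ((z₀.1, x) : ℝ × EuclideanSpace ℝ (Fin 3)) p ≠ ∞ := by
    intro x hx ρ hρ hρR
    rw [cknD]
    refine ENNReal.mul_ne_top (ENNReal.inv_ne_top.2 (pow_ne_zero _ (ENNReal.ofReal_pos.2 hρ).ne')) ?_
    exact ne_top_of_le_ne_top hpint.ne (lintegral_mono_set (hsub x hx.1 ρ hρ hρR))
  -- `A(ρ; (t₀, x)) ≤ 𝐈`
  have hA : ∀ x ∈ S, ∀ ρ, 0 < ρ → ρ ≤ R / 2 →
      cknAEss ρ ((z₀.1, x) : ℝ × EuclideanSpace ℝ (Fin 3)) u ≤ I.toNNReal := by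
    intro x hx ρ hρ hρR
    rw [ENNReal.coe_toNNReal hItop]
    exact cknAEss_le_abScaledSum.trans (abScaledSum_le_typeIBound hρ (hsub x hx.1 ρ hρ hρR))
  exact hausdorffMeasure_topSingular_eq_zero hsw hG hR2 hslab measurableSet_ball
    measure_ball_lt_top.ne hgrad (fun x hx => ball_subset_ball' (by
      have := mem_ball.1 hx.1; linarith)) hA hD (fun x hx => hx.2)

/-! ### The slab form: suitable on `I × ℝ³`, `𝐈` finite on one cylinder touching the top -/

/-- **Top-time singular sets are `H¹`-null — slab form** (the shape the blow-up engine produces): a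
suitable pair on `I × ℝ³` with weak gradient, `(t₀ − R², t₀) ⊆ I`, `𝐈(Q((t₀, x₀), R)) ≤ M < ∞` ⇒
`{x ∈ B(x₀, R/2) : (t₀, x) backward-singular}` is `μH[1]`-null (pressure re-gauged by its `B(x₀, R)`-mean,
`IsSuitableWeakSolutionOn.sub_ballMean_slab`, `cknD_sub_ballMean_le_of_typeIBound_le`). -/
theorem hausdorffMeasure_topSingular_eq_zero_slab {I : Set ℝ} {hI : IsOpen I}
    {u : ℝ → EuclideanSpace ℝ (Fin 3) → EuclideanSpace ℝ (Fin 3)}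
    {p : ℝ → EuclideanSpace ℝ (Fin 3) → ℝ}
    {G : ℝ → EuclideanSpace ℝ (Fin 3) → EuclideanSpace ℝ (Fin 3) →L[ℝ] EuclideanSpace ℝ (Fin 3)}
    (hsw : IsSuitableWeakSolutionOn (slab (EuclideanSpace ℝ (Fin 3)) I hI) 1 0 u p)
    (hG : HasWeakSpatialGradientOn (slab (EuclideanSpace ℝ (Fin 3)) I hI) u G)
    {t₀ : ℝ} {x₀ : EuclideanSpace ℝ (Fin 3)} {R : ℝ} (hR : 0 < R) (hIR : Ioo (t₀ - R ^ 2) t₀ ⊆ I)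
    {M : ℝ≥0∞} (hM : M ≠ ⊤)
    (hbd : typeIBound (parabolicCylinder R ((t₀, x₀) : ℝ × EuclideanSpace ℝ (Fin 3))) u p G ≤ M) :
    μH[1] {x ∈ ball x₀ (R / 2) |
      IsBackwardSingularPoint u ((t₀, x) : ℝ × EuclideanSpace ℝ (Fin 3))} = 0 := by
  set z₀ : ℝ × EuclideanSpace ℝ (Fin 3) := (t₀, x₀) with hz₀
  set p' : ℝ → EuclideanSpace ℝ (Fin 3) → ℝ := fun t x => p t x - ⨍ y in ball x₀ R, p t y with hp'
  have hsw' : IsSuitableWeakSolutionOn (slab (EuclideanSpace ℝ (Fin 3)) I hI) 1 0 u p' :=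
    hsw.sub_ballMean_slab x₀ hR
  set S : Set (EuclideanSpace ℝ (Fin 3)) :=
    {x ∈ ball x₀ (R / 2) | IsBackwardSingularPoint u ((t₀, x) : ℝ × EuclideanSpace ℝ (Fin 3))}
    with hSdef
  have hR2 : 0 < R / 2 := by positivity
  have hsub : ∀ x ∈ ball x₀ (R / 2), ∀ ρ, 0 < ρ → ρ ≤ R / 2 →
      parabolicCylinder ρ ((t₀, x) : ℝ × EuclideanSpace ℝ (Fin 3)) ⊆ parabolicCylinder R z₀ := by
    intro x hx ρ hρ hρR w hw
    rw [mem_parabolicCylinder] at hw ⊢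
    simp only [hz₀] at hw ⊢
    refine ⟨⟨?_, hw.1.2⟩, ?_⟩
    · have : ρ ^ 2 ≤ R ^ 2 := by nlinarith
      linarith [hw.1.1]
    · rw [mem_ball] at hx
      calc dist w.2 x₀ ≤ dist w.2 x + dist x x₀ := dist_triangle _ _ _
        _ < ρ + R / 2 := add_lt_add hw.2 hx
        _ ≤ R := by linarith
  have hslab : Ioo (t₀ - (R / 2) ^ 2) t₀ ×ˢ ball x₀ R ⊆
      ((slab (EuclideanSpace ℝ (Fin 3)) I hI : Opens (ℝ × EuclideanSpace ℝ (Fin 3))) :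
        Set (ℝ × EuclideanSpace ℝ (Fin 3))) := by
    rw [coe_slab]
    refine prod_mono (fun s hs => hIR ⟨?_, hs.2⟩) (subset_univ _)
    have : (R / 2) ^ 2 ≤ R ^ 2 := by nlinarith
    linarith [hs.1]
  have hslabQ : Ioo (t₀ - (R / 2) ^ 2) t₀ ×ˢ ball x₀ R ⊆ parabolicCylinder R z₀ := by
    rintro ⟨s, y⟩ ⟨hs, hy⟩
    rw [mem_parabolicCylinder]
    refine ⟨⟨?_, hs.2⟩, mem_ball.1 hy⟩
    have : (R / 2) ^ 2 ≤ R ^ 2 := by nlinarith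
    simp only [hz₀]
    linarith [hs.1]
  -- `∫∫ |∇u|² < ∞` on the slab, from `E(R; z₀) ≤ M`
  have hR0 : ENNReal.ofReal R ≠ 0 := (ENNReal.ofReal_pos.2 hR).ne'
  have hgradQ : ∫⁻ w in parabolicCylinder R z₀, ENNReal.ofReal (frobeniusNormSq (G w.1 w.2)) ≠ ∞ := by
    have hE : cknE R z₀ G ≤ M :=
      (cknE_le_abScaledSum.trans (abScaledSum_le_typeIBound hR subset_rfl)).trans hbd
    have h1 : ∫⁻ w in parabolicCylinder R z₀, ENNReal.ofReal (frobeniusNormSq (G w.1 w.2)) ≤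
        ENNReal.ofReal R * M := by
      rw [cknE] at hE
      exact (ENNReal.inv_mul_le_iff hR0 ENNReal.ofReal_ne_top).1 hE
    exact ne_top_of_le_ne_top (ENNReal.mul_ne_top ENNReal.ofReal_ne_top hM) h1
  have hgrad : ∫⁻ w in Ioo (t₀ - (R / 2) ^ 2) t₀ ×ˢ ball x₀ R,
      ENNReal.ofReal (frobeniusNormSq (G w.1 w.2)) ≠ ∞ :=
    ne_top_of_le_ne_top hgradQ (lintegral_mono_set hslabQ)
  -- `D(ρ; (t₀, x))[p'] < ∞` from `D(R; z₀)[p'] = P(R; z₀)[p] ≤ M`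
  have hDR : cknD R z₀ p' ≤ M := cknD_sub_ballMean_le_of_typeIBound_le hbd hR subset_rfl
  have hpint : ∫⁻ w in parabolicCylinder R z₀, ‖p' w.1 w.2‖ₑ ^ (3 / 2 : ℝ) ≠ ∞ := by
    have h1 : ∫⁻ w in parabolicCylinder R z₀, ‖p' w.1 w.2‖ₑ ^ (3 / 2 : ℝ) ≤
        ENNReal.ofReal R ^ 2 * M := by
      rw [cknD] at hDR
      exact (ENNReal.inv_mul_le_iff (pow_ne_zero _ hR0) (ENNReal.pow_ne_top ENNReal.ofReal_ne_top)).1 hDR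
    exact ne_top_of_le_ne_top (ENNReal.mul_ne_top (ENNReal.pow_ne_top ENNReal.ofReal_ne_top) hM) h1
  have hD : ∀ x ∈ S, ∀ ρ, 0 < ρ → ρ ≤ R / 2 →
      cknD ρ ((t₀, x) : ℝ × EuclideanSpace ℝ (Fin 3)) p' ≠ ∞ := by
    intro x hx ρ hρ hρR
    rw [cknD]
    refine ENNReal.mul_ne_top (ENNReal.inv_ne_top.2 (pow_ne_zero _ (ENNReal.ofReal_pos.2 hρ).ne')) ?_
    exact ne_top_of_le_ne_top hpint (lintegral_mono_set (hsub x hx.1 ρ hρ hρR))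
  -- `A(ρ; (t₀, x)) ≤ M`
  have hA : ∀ x ∈ S, ∀ ρ, 0 < ρ → ρ ≤ R / 2 →
      cknAEss ρ ((t₀, x) : ℝ × EuclideanSpace ℝ (Fin 3)) u ≤ M.toNNReal := by
    intro x hx ρ hρ hρR
    rw [ENNReal.coe_toNNReal hM]
    exact (cknAEss_le_abScaledSum.trans (abScaledSum_le_typeIBound hρ (hsub x hx.1 ρ hρ hρR))).trans hbd
  exact hausdorffMeasure_topSingular_eq_zero hsw' hG hR2 hslab measurableSet_ball
    measure_ball_lt_top.ne hgrad (fun x hx => ball_subset_ball' (by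
      have := mem_ball.1 hx.1; linarith)) hA hD (fun x hx => hx.2)

end Summit.NavierStokesRegularity.NavierStokesRegularity.Cruxes.ScarEnvelopeTypeI.SliceBudget

end
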